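import Mathlib
import Summits.MatrixMultiplication.Statement
import Literature.Computability.AlgebraicComplexity.TensorRestrictionRank
import Summits.MatrixMultiplication.MatrixMultiplication.Theorems.GraphEquationsHasseSchmidt
import Summits.MatrixMultiplication.MatrixMultiplication.Theorems.GraphEquationsCoeffIdentity

/-!
# Graph equations — THE GAP DIAL: the finite range is indexed by `e - d`, not by `e` (M21d, decomp-mm-lens-5 g34)

(supports `MultiplicityReduction`, stmt-MatrixMultiplication-27806; extends `GraphEquationsHasseSchmidt`
(M21a).  No new definition.)

A test family `t_o ∈ I^d` (`d = k+1 ≥ 1`) with `f_q^e ∈ (t_o)` (`e = k+m`) has VANISHING ORDER `d` and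
MEMBERSHIP EXPONENT `e`; call `g = e - d = m - 1` its GAP.  Hasse–Schmidt AD along the vertical field
(`exists_verticalHasse`) trades order for exponent one-for-one at quadratic cost:

  `gapReduction`:  order `k+1`, exponent `k+m`, nonscalar length `N`
                   ⟹  order `1`, exponent `m`, nonscalar length `C(k+2,2)·N`, still inside `I`

(`[s^k](s + f_q)^{k+m} = C(k+m,k)·f_q^m`, and the modes `[s^l]Θt_o`, `l ≤ k`, lie in `I^{k+1-l} ⊆ I`).
So the rung a family needs is the rung of its GAP `+ 1`; M21a is the case `m = 2`.

With the FAMILY ε-RUNG (system-free form of M21b's `RUNG^ε`)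

  FR(m) : ∀ ε > 0 ∃ C ∀ n ≥ 1 ∀ finite families `t_o ∈ I` of format `n`, nonscalar length `≤ N`,
          with `f_q^m ∈ (t_o)` (∀ q):  R(⟨n,n,n⟩) ≤ C · n^ε · (N + n²)

and the GAP HAND

  GH(m) : for `β ≥ 2`, `EqAdmissible β ⇒ ∀ β' > β ∃ c ∀ n ≥ 1 ∃ E k`, `E` correct of format `n`, tests in
          `I^{k+1}`, `f_q^{k+m} ∈ J_E (∀ q)`, `C(k+2,2)·cost E ≤ c·n^{β'}`,

this file proves, for EVERY `m ≥ 1`: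
* `familyRung_of_matrixMultiplication` (FR(m) is NEC), `familyRung_of_le_two` (FR(1), FR(2) hold, `C = 6`,
  `ε = 0`: M19m/M21a), `exists_gapFamily_of_omega_lt` / `gapHand_of_matrixMultiplication` (GH(m) is NEC);
* `gapRung_of_familyRung` — **FR(m) serves every family of gap `≤ m-1`**, whatever its order and exponent;
* `multiplicityReduction_of_gapDial` — **GH(m) ∧ FR(m) ⇒ MultiplicityReduction**;
* `matrixMultiplication_iff_gapDial` — **EXACT for every `m ≥ 1`: `ω = 2 ⟺ V ∧ GH(m) ∧ FR(m)`**, and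
  `matrixMultiplication_iff_quadratic_gapHand_of_le_two` — for `m ≤ 2` the rung is a theorem: `ω = 2 ⟺ V ∧ GH(m)`.

THE DIAL (lens 5, «how far must the finite range reach»): one parameter `m` trades hand against range —
raising `m` WEAKENS the hand (more slack between order and exponent is tolerated) and STRENGTHENS the rung.
`m ≤ 2`: range proved, all weight on the hand (M21c's tight hand is `m = 2`); `m = e`, `k = 0`: the hand is
NER's uniform-exponent family and the range is `RUNG^ε(e)` (M21b).  The first open rung is `FR(3)` = gap 2.
-/

set_option linter.dupNamespace false

noncomputable section

open scoped BigOperators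

namespace Summit.MatrixMultiplication.MatrixMultiplication.Theorems.GraphEquations

open MvPolynomial
open Literature.Computability.AlgebraicComplexity
open Literature.Computability.AlgebraicComplexity.ArithCircuit

variable {n : ℕ}

/-! ## Order for exponent: the gap reduction -/

/-- If `Θ f_q = s + f_q` for all `q` and `f_q^{k+m} ∈ (t_o)_o`, then `f_q^m` lies in the ideal generated by
the Hasse–Schmidt modes `[s^l]Θ t_o`, `l ≤ k` (`[s^k](s + f_q)^{k+m} = C(k+m,k)·f_q^m`, `char ℂ = 0`). -/
theorem pow_mem_span_hasseModes
    (Θ : MvPolynomial (GraphVars n) ℂ →ₐ[ℂ] Polynomial (MvPolynomial (GraphVars n) ℂ))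
    (h2 : ∀ q : Fin n × Fin n, Θ (generator n q) = Polynomial.X + Polynomial.C (generator n q))
    (k m : ℕ) {ι : Type*} [Fintype ι] (t : ι → MvPolynomial (GraphVars n) ℂ) {q : Fin n × Fin n}
    (hmem : generator n q ^ (k + m) ∈ Ideal.span (Set.range t)) :
    generator n q ^ m ∈
      Ideal.span (Set.range fun lo : Fin (k + 1) × ι => (Θ (t lo.2)).coeff (lo.1 : ℕ)) := by
  classical
  set J := Ideal.span (Set.range fun lo : Fin (k + 1) × ι => (Θ (t lo.2)).coeff (lo.1 : ℕ)) with hJ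
  obtain ⟨h, hh⟩ := Ideal.mem_span_range_iff_exists_fun.mp hmem
  have hcoeff := congrArg (fun P : Polynomial (MvPolynomial (GraphVars n) ℂ) => P.coeff k)
    (congrArg Θ hh)
  simp only [map_sum, map_mul, map_pow, h2, Polynomial.finsetSum_coeff, Polynomial.coeff_mul,
    Polynomial.coeff_X_add_C_pow, show k + m - k = m by omega] at hcoeff
  have key : generator n q ^ m * ((k + m).choose k : MvPolynomial (GraphVars n) ℂ) ∈ J := by
    rw [← hcoeff]
    refine Ideal.sum_mem _ fun o _ => Ideal.sum_mem _ fun il hil => ?_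
    rw [Finset.HasAntidiagonal.mem_antidiagonal] at hil
    exact Ideal.mul_mem_left _ _ (Ideal.subset_span ⟨(⟨il.2, by omega⟩, o), rfl⟩)
  have hc : ((k + m).choose k : ℂ) ≠ 0 := by exact_mod_cast (Nat.choose_pos (by omega)).ne'
  have hgen : generator n q ^ m = C (((k + m).choose k : ℂ)⁻¹) *
      (generator n q ^ m * ((k + m).choose k : MvPolynomial (GraphVars n) ℂ)) := by
    rw [← map_natCast (C : ℂ →+* MvPolynomial (GraphVars n) ℂ), mul_comm (generator n q ^ m),
      ← mul_assoc, ← map_mul, inv_mul_cancel₀ hc, map_one, one_mul]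
  rw [hgen]
  exact Ideal.mul_mem_left _ _ key

/-- **THE GAP REDUCTION.**  A finite family `t_o ∈ I^{k+1}` of nonscalar length `≤ N` with
`f_q^{k+m} ∈ (t_o)` for all `q` yields a finite family INSIDE `I`, of nonscalar length `≤ C(k+2,2)·N`, with
`f_q^m` in its ideal for all `q`: order `k+1 ↦ 1`, exponent `k+m ↦ m`, the gap `m-1` unchanged. -/
theorem gapReduction (k m : ℕ) {N : ℕ} {ι : Type*} [Fintype ι] (t : ι → MvPolynomial (GraphVars n) ℂ)
    (hspan : ∃ gs : List (MvPolynomial (GraphVars n) ℂ), IsNonscalarSeq gs ∧ gs.length ≤ N ∧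
      ∀ o, t o ∈ freeSpan {q | q ∈ gs})
    (ht : ∀ o, t o ∈ graphIdeal n ^ (k + 1))
    (hmem : ∀ q : Fin n × Fin n, generator n q ^ (k + m) ∈ Ideal.span (Set.range t)) :
    ∃ t' : Fin (k + 1) × ι → MvPolynomial (GraphVars n) ℂ,
      (∀ lo, t' lo ∈ graphIdeal n) ∧
      (∃ gs' : List (MvPolynomial (GraphVars n) ℂ), IsNonscalarSeq gs' ∧
        gs'.length ≤ (k + 2).choose 2 * N ∧ ∀ lo, t' lo ∈ freeSpan {q | q ∈ gs'}) ∧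
      ∀ q : Fin n × Fin n, generator n q ^ m ∈ Ideal.span (Set.range t') := by
  obtain ⟨Θ, h0, h1, h2⟩ := exists_verticalHasse n
  obtain ⟨gs, hns, hlen, hfs⟩ := hspan
  obtain ⟨gs', hns', hlen', hT⟩ := IsNonscalarSeq.hasse_affine Θ h1 k hns
  refine ⟨fun lo => (Θ (t lo.2)).coeff (lo.1 : ℕ), fun lo => ?_,
    ⟨gs', hns', hlen'.trans (Nat.mul_le_mul_left _ hlen), fun lo =>
      hT _ (hfs lo.2) lo.1 (Nat.lt_succ_iff.mp lo.1.isLt)⟩,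
    fun q => pow_mem_span_hasseModes Θ h2 k m t (hmem q)⟩
  have h := hasse_coeff_mem_pow Θ h0 (graphIdeal n) (k + 1) (ht lo.2) (lo.1 : ℕ)
  have hl : 1 ≤ k + 1 - (lo.1 : ℕ) := by have := lo.1.isLt; omega
  simpa only [pow_one] using Ideal.pow_le_pow_right hl h

/-! ## The family ε-rung: necessary, and a theorem for `m ≤ 2` -/

/-- **NEC**: `ω = 2 ⇒ FR(m)` for every `m` (`R(⟨n,n,n⟩) ≤ C_ε n^{2+ε}` regardless of the family). -/
theorem familyRung_of_matrixMultiplication (hS : _root_.MatrixMultiplication) (m : ℕ) :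
    ∀ ε : ℝ, 0 < ε → ∃ C : ℝ, ∀ n : ℕ, 1 ≤ n → ∀ (N T : ℕ) (t : Fin T → MvPolynomial (GraphVars n) ℂ),
      (∀ o, t o ∈ graphIdeal n) →
      (∃ gs : List (MvPolynomial (GraphVars n) ℂ), IsNonscalarSeq gs ∧ gs.length ≤ N ∧
        ∀ o, t o ∈ freeSpan {q | q ∈ gs}) →
      (∀ q : Fin n × Fin n, generator n q ^ m ∈ Ideal.span (Set.range t)) →
      (tensorRank (matMulTensor ℂ n n n) : ℝ) ≤ C * (n : ℝ) ^ ε * ((N : ℝ) + n * n) := by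
  intro ε hε
  have hω : omega ℂ = 2 := hS
  obtain ⟨C, hC, hb⟩ := exists_tensorRank_matMulTensor_le_rpow ℂ hε
  refine ⟨C, fun n hn N _ _ _ _ _ => ?_⟩
  have hn0 : (0 : ℝ) < n := by exact_mod_cast hn
  have h1 := hb n hn
  rw [hω, Real.rpow_add hn0, show ((2 : ℝ)) = ((2 : ℕ) : ℝ) by norm_num, Real.rpow_natCast, sq] at h1
  have hε0 : (0 : ℝ) ≤ (n : ℝ) ^ ε := Real.rpow_nonneg hn0.le ε
  have hN : (0 : ℝ) ≤ (N : ℝ) := Nat.cast_nonneg _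
  calc (tensorRank (matMulTensor ℂ n n n) : ℝ) ≤ C * ((n : ℝ) * n * (n : ℝ) ^ ε) := h1
    _ = C * (n : ℝ) ^ ε * ((n : ℝ) * n) := by ring
    _ ≤ C * (n : ℝ) ^ ε * ((N : ℝ) + n * n) :=
        mul_le_mul_of_nonneg_left (by linarith) (mul_nonneg hC.le hε0)

/-- **FR(1) and FR(2) are theorems** (`C = 6`, `ε = 0`): the `e = 2` exact engine for families (M21a). -/
theorem familyRung_of_le_two {m : ℕ} (hm : m ≤ 2) :
    ∀ ε : ℝ, 0 < ε → ∃ C : ℝ, ∀ n : ℕ, 1 ≤ n → ∀ (N T : ℕ) (t : Fin T → MvPolynomial (GraphVars n) ℂ),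
      (∀ o, t o ∈ graphIdeal n) →
      (∃ gs : List (MvPolynomial (GraphVars n) ℂ), IsNonscalarSeq gs ∧ gs.length ≤ N ∧
        ∀ o, t o ∈ freeSpan {q | q ∈ gs}) →
      (∀ q : Fin n × Fin n, generator n q ^ m ∈ Ideal.span (Set.range t)) →
      (tensorRank (matMulTensor ℂ n n n) : ℝ) ≤ C * (n : ℝ) ^ ε * ((N : ℝ) + n * n) := by
  intro ε hε
  refine ⟨6, fun n hn N T t ht hspan hmem => ?_⟩
  have hsq : ∀ q : Fin n × Fin n, generator n q ^ 2 ∈ Ideal.span (Set.range t) := fun q => by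
    have h := Ideal.mul_mem_left _ (generator n q ^ (2 - m)) (hmem q)
    rwa [← pow_add, show 2 - m + m = 2 by omega] at h
  have hR : (tensorRank (matMulTensor ℂ n n n) : ℝ) ≤ 6 * N := by
    exact_mod_cast (tensorRank_le_of_sqMembers_family t hspan ht hsq).trans_eq (by ring)
  have hn1 : (1 : ℝ) ≤ n := by exact_mod_cast hn
  have hε1 : (1 : ℝ) ≤ (n : ℝ) ^ ε := Real.one_le_rpow hn1 hε.le
  have hN : (0 : ℝ) ≤ (N : ℝ) := Nat.cast_nonneg _
  nlinarith [mul_nonneg hN (sub_nonneg.2 hε1), mul_self_nonneg (n : ℝ),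
    mul_nonneg (mul_self_nonneg (n : ℝ)) (le_trans zero_le_one hε1)]

/-! ## FR(m) serves every family of gap at most `m - 1` -/

/-- **THE GAP RUNG.**  `FR(m)` bounds the rank for every correct system whose tests lie in `I^{k+1}` and
whose test ideal contains `f_q^{k+m}` — for every `k`:  `R(⟨n,n,n⟩) ≤ C_ε·n^ε·(C(k+2,2)·cost E + n²)`. -/
theorem gapRung_of_familyRung {m : ℕ}
    (hF : ∀ ε : ℝ, 0 < ε → ∃ C : ℝ, ∀ n : ℕ, 1 ≤ n → ∀ (N T : ℕ) (t : Fin T → MvPolynomial (GraphVars n) ℂ),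
      (∀ o, t o ∈ graphIdeal n) →
      (∃ gs : List (MvPolynomial (GraphVars n) ℂ), IsNonscalarSeq gs ∧ gs.length ≤ N ∧
        ∀ o, t o ∈ freeSpan {q | q ∈ gs}) →
      (∀ q : Fin n × Fin n, generator n q ^ m ∈ Ideal.span (Set.range t)) →
      (tensorRank (matMulTensor ℂ n n n) : ℝ) ≤ C * (n : ℝ) ^ ε * ((N : ℝ) + n * n)) :
    ∀ ε : ℝ, 0 < ε → ∃ C : ℝ, ∀ n : ℕ, 1 ≤ n → ∀ (E : EqSystem n) (k : ℕ), E.Correct →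
      (∀ j ∈ E.tests, E.testPoly j ∈ graphIdeal n ^ (k + 1)) →
      (∀ q : Fin n × Fin n, generator n q ^ (k + m) ∈
        Ideal.span (Set.range fun o : Fin E.tests.length => E.testPoly (E.tests.get o))) →
      (tensorRank (matMulTensor ℂ n n n) : ℝ) ≤
        C * (n : ℝ) ^ ε * (((k + 2).choose 2 : ℝ) * (E.cost : ℝ) + n * n) := by
  classical
  intro ε hε
  obtain ⟨C, hC⟩ := hF ε hε
  refine ⟨C, fun n hn E k hE hdeep hmem => ?_⟩
  obtain ⟨gs, hns, hlen, hfs⟩ := exists_isNonscalarSeq_tests E hE.1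
  obtain ⟨t', hI, hspan', hmem'⟩ := gapReduction k m (N := E.cost)
    (fun o : Fin E.tests.length => E.testPoly (E.tests.get o)) ⟨gs, hns, hlen, hfs⟩
    (fun o => hdeep _ (List.get_mem E.tests o)) hmem
  set e := (Fintype.equivFin (Fin (k + 1) × Fin E.tests.length)).symm with he
  have hrange : Set.range (t' ∘ e) = Set.range t' := e.surjective.range_comp t'
  obtain ⟨gs', hns', hlen', hfs'⟩ := hspan'
  have h := hC n hn ((k + 2).choose 2 * E.cost) _ (t' ∘ e) (fun o => hI _)
    ⟨gs', hns', hlen', fun o => hfs' _⟩ (fun q => by rw [hrange]; exact hmem' q)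
  simpa only [Nat.cast_mul] using h

/-! ## The gap hand: necessary; with FR(m) it decides the crux -/

/-- **NEC (absolute form)**: above `ω`, REDUCED families (`k = 0`, `f_q ∈ J_E`, so `f_q^m ∈ J_E`). -/
theorem exists_gapFamily_of_omega_lt {β : ℝ} (hβ : omega ℂ < β) {m : ℕ} (hm : 1 ≤ m) :
    ∃ c : ℝ, ∀ n : ℕ, 1 ≤ n → ∃ (E : EqSystem n) (k : ℕ), E.Correct ∧
      (∀ j ∈ E.tests, E.testPoly j ∈ graphIdeal n ^ (k + 1)) ∧
      (∀ q : Fin n × Fin n, generator n q ^ (k + m) ∈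
        Ideal.span (Set.range fun o : Fin E.tests.length => E.testPoly (E.tests.get o))) ∧
      ((k + 2).choose 2 : ℝ) * (E.cost : ℝ) ≤ c * (n : ℝ) ^ β := by
  obtain ⟨c, hc⟩ := exists_correct_generator_mem_of_omega_lt hβ
  refine ⟨c, fun n hn => ?_⟩
  obtain ⟨E, hE, hmem, hcost⟩ := hc n hn
  refine ⟨E, 0, hE, fun j hj => ?_, fun q => ?_, ?_⟩
  · simpa only [zero_add, pow_one] using hE.testPoly_mem_graphIdeal' hj
  · have h1 := hmem q
    rw [pow_one] at h1
    simpa only [zero_add] using Ideal.pow_mem_of_mem _ h1 m hm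
  · simpa [Nat.choose] using hcost

/-- **NEC**: `ω = 2 ⇒ GH(m)` for every `m ≥ 1`. -/
theorem gapHand_of_matrixMultiplication (hS : _root_.MatrixMultiplication) {m : ℕ} (hm : 1 ≤ m) :
    ∀ β : ℝ, 2 ≤ β → EqAdmissible β → ∀ β' : ℝ, β < β' →
      ∃ c : ℝ, ∀ n : ℕ, 1 ≤ n → ∃ (E : EqSystem n) (k : ℕ), E.Correct ∧
        (∀ j ∈ E.tests, E.testPoly j ∈ graphIdeal n ^ (k + 1)) ∧
        (∀ q : Fin n × Fin n, generator n q ^ (k + m) ∈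
          Ideal.span (Set.range fun o : Fin E.tests.length => E.testPoly (E.tests.get o))) ∧
        ((k + 2).choose 2 : ℝ) * (E.cost : ℝ) ≤ c * (n : ℝ) ^ β' := by
  intro β hβ _ β' hβ'
  have h2 : omega ℂ = 2 := hS
  exact exists_gapFamily_of_omega_lt (by rw [h2]; linarith) hm

/-- **THE GAP-DIAL BRIDGE**: `GH(m) ∧ FR(m) ⇒ MultiplicityReduction`. -/
theorem multiplicityReduction_of_gapDial {m : ℕ}
    (hF : ∀ ε : ℝ, 0 < ε → ∃ C : ℝ, ∀ n : ℕ, 1 ≤ n → ∀ (N T : ℕ) (t : Fin T → MvPolynomial (GraphVars n) ℂ),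
      (∀ o, t o ∈ graphIdeal n) →
      (∃ gs : List (MvPolynomial (GraphVars n) ℂ), IsNonscalarSeq gs ∧ gs.length ≤ N ∧
        ∀ o, t o ∈ freeSpan {q | q ∈ gs}) →
      (∀ q : Fin n × Fin n, generator n q ^ m ∈ Ideal.span (Set.range t)) →
      (tensorRank (matMulTensor ℂ n n n) : ℝ) ≤ C * (n : ℝ) ^ ε * ((N : ℝ) + n * n))
    (hH : ∀ β : ℝ, 2 ≤ β → EqAdmissible β → ∀ β' : ℝ, β < β' →
      ∃ c : ℝ, ∀ n : ℕ, 1 ≤ n → ∃ (E : EqSystem n) (k : ℕ), E.Correct ∧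
        (∀ j ∈ E.tests, E.testPoly j ∈ graphIdeal n ^ (k + 1)) ∧
        (∀ q : Fin n × Fin n, generator n q ^ (k + m) ∈
          Ideal.span (Set.range fun o : Fin E.tests.length => E.testPoly (E.tests.get o))) ∧
        ((k + 2).choose 2 : ℝ) * (E.cost : ℝ) ≤ c * (n : ℝ) ^ β') :
    MultiplicityReduction := by
  intro β hβ hA βs hβs
  obtain ⟨c, hc⟩ := hH β hβ hA ((β + βs) / 2) (by linarith)
  obtain ⟨C, hC⟩ := gapRung_of_familyRung hF ((βs - β) / 4) (by linarith)
  have hω : omega ℂ ≤ (β + βs) / 2 + (βs - β) / 4 := by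
    refine omega_le_of_rank_family_le (K := max C 0 * (c + 1)) fun n hn => ?_
    obtain ⟨E, k, hE, hdeep, hmem, hcost⟩ := hc n hn
    have hn0 : (0 : ℝ) < n := by exact_mod_cast hn
    have h1 := hC n hn E k hE hdeep hmem
    have hX0 : (0 : ℝ) ≤ ((k + 2).choose 2 : ℝ) * (E.cost : ℝ) + n * n := by positivity
    have hε0 : (0 : ℝ) ≤ (n : ℝ) ^ ((βs - β) / 4) := Real.rpow_nonneg hn0.le _
    have h2 : C * (n : ℝ) ^ ((βs - β) / 4) * (((k + 2).choose 2 : ℝ) * (E.cost : ℝ) + n * n) ≤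
        max C 0 * (n : ℝ) ^ ((βs - β) / 4) * (((k + 2).choose 2 : ℝ) * (E.cost : ℝ) + n * n) :=
      mul_le_mul_of_nonneg_right (mul_le_mul_of_nonneg_right (le_max_left _ _) hε0) hX0
    have hsq := natCast_mul_self_le_rpow hn (show (2 : ℝ) ≤ (β + βs) / 2 by linarith)
    have h3 : ((k + 2).choose 2 : ℝ) * (E.cost : ℝ) + n * n ≤ (c + 1) * (n : ℝ) ^ ((β + βs) / 2) := by
      linarith
    have h4 : max C 0 * (n : ℝ) ^ ((βs - β) / 4) * (((k + 2).choose 2 : ℝ) * (E.cost : ℝ) + n * n) ≤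
        max C 0 * (n : ℝ) ^ ((βs - β) / 4) * ((c + 1) * (n : ℝ) ^ ((β + βs) / 2)) :=
      mul_le_mul_of_nonneg_left h3 (mul_nonneg (le_max_right _ _) hε0)
    have h5 : max C 0 * (n : ℝ) ^ ((βs - β) / 4) * ((c + 1) * (n : ℝ) ^ ((β + βs) / 2)) =
        max C 0 * (c + 1) * (n : ℝ) ^ ((β + βs) / 2 + (βs - β) / 4) := by
      rw [Real.rpow_add hn0]; ring
    linarith
  exact eqAdmissibleRed_of_omega_lt (hω.trans_lt (by linarith))

/-- **EXACT, for every `m ≥ 1`**: `ω = 2 ⟺ V ∧ GH(m) ∧ FR(m)`. -/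
theorem matrixMultiplication_iff_gapDial {m : ℕ} (hm : 1 ≤ m) :
    _root_.MatrixMultiplication ↔
      GraphEquationsQuadratic ∧
      (∀ β : ℝ, 2 ≤ β → EqAdmissible β → ∀ β' : ℝ, β < β' →
        ∃ c : ℝ, ∀ n : ℕ, 1 ≤ n → ∃ (E : EqSystem n) (k : ℕ), E.Correct ∧
          (∀ j ∈ E.tests, E.testPoly j ∈ graphIdeal n ^ (k + 1)) ∧
          (∀ q : Fin n × Fin n, generator n q ^ (k + m) ∈
            Ideal.span (Set.range fun o : Fin E.tests.length => E.testPoly (E.tests.get o))) ∧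
          ((k + 2).choose 2 : ℝ) * (E.cost : ℝ) ≤ c * (n : ℝ) ^ β') ∧
      (∀ ε : ℝ, 0 < ε → ∃ C : ℝ, ∀ n : ℕ, 1 ≤ n → ∀ (N T : ℕ) (t : Fin T → MvPolynomial (GraphVars n) ℂ),
        (∀ o, t o ∈ graphIdeal n) →
        (∃ gs : List (MvPolynomial (GraphVars n) ℂ), IsNonscalarSeq gs ∧ gs.length ≤ N ∧
          ∀ o, t o ∈ freeSpan {q | q ∈ gs}) →
        (∀ q : Fin n × Fin n, generator n q ^ m ∈ Ideal.span (Set.range t)) →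
        (tensorRank (matMulTensor ℂ n n n) : ℝ) ≤ C * (n : ℝ) ^ ε * ((N : ℝ) + n * n)) := by
  constructor
  · intro hS
    exact ⟨nec_quadratic hS, gapHand_of_matrixMultiplication hS hm, familyRung_of_matrixMultiplication hS m⟩
  · rintro ⟨hV, hH, hF⟩
    exact matrixMultiplication_of_quadratic_of_multiplicityReduction hV (multiplicityReduction_of_gapDial hF hH)

/-- **For `m ≤ 2` the rung is a theorem**: `ω = 2 ⟺ V ∧ GH(m)` (`m = 2` is the tight hand of M21c). -/
theorem matrixMultiplication_iff_quadratic_gapHand_of_le_two {m : ℕ} (hm1 : 1 ≤ m) (hm2 : m ≤ 2) :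
    _root_.MatrixMultiplication ↔
      GraphEquationsQuadratic ∧
      (∀ β : ℝ, 2 ≤ β → EqAdmissible β → ∀ β' : ℝ, β < β' →
        ∃ c : ℝ, ∀ n : ℕ, 1 ≤ n → ∃ (E : EqSystem n) (k : ℕ), E.Correct ∧
          (∀ j ∈ E.tests, E.testPoly j ∈ graphIdeal n ^ (k + 1)) ∧
          (∀ q : Fin n × Fin n, generator n q ^ (k + m) ∈
            Ideal.span (Set.range fun o : Fin E.tests.length => E.testPoly (E.tests.get o))) ∧
          ((k + 2).choose 2 : ℝ) * (E.cost : ℝ) ≤ c * (n : ℝ) ^ β') := by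
  rw [matrixMultiplication_iff_gapDial hm1]
  exact ⟨fun h => ⟨h.1, h.2.1⟩, fun h => ⟨h.1, h.2, familyRung_of_le_two hm2⟩⟩

end Summit.MatrixMultiplication.MatrixMultiplication.Theorems.GraphEquations

end
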